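/-
Copyright: the b2b-balaban cell (near-miss cell 7), T⁴-continuum fan-out, lineage t4-ne7b-p3 (node U5c LARGE-DEVIATION
member P3).  Released under the licence of the surrounding project.
-/
import Summits.QuantumFields.BalabanUV.T4Continuum.Support.SpaceTimePeierls

/-!
# Space-time Peierls ∕ Cramér route for NE7b — a decided WITNESS: every binder of the END at once, non-vacuously

Summits-side support leaf of the T⁴-continuum cell (rung (B)+1 on a FINITE torus only; NOT infinite volume, NOT the
mass gap, NOT the Clay statement; NOT a proof of the spine estimate NE7b).  Lineage `t4-ne7b-p3` (generation 1), node
U5c, skeleton `t4/skeletons/NE7b-t4-ne7b-p3.md` row ST11.  [folklore] finite combinatorics; nothing is quoted from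
print and nothing printed is asserted; no `[cite:]` tag.

THE MODEL (the product-cell heuristic of the route, with one cell per scale).  Cells = scales `0, …, K`; a term is the
SET of occupied scales `S ⊆ {0, …, K}` with weight `(1/2)^{#S}` (independent occupation at price `q = e^{−s₁} = 1/2`,
`s₁ = log 2`); adjacency = consecutive scales, so the contour through the top scale `K` is the maximal run
`{K+1−n, …, K} ⊆ S`; the pinned class of the run of length `n` is `{S′ ∪ {K+1−n, …, K} : S′ ⊆ {0, …, K−n−1}}` with mass
`(1/2)^n · (3/2)^{K−n} ≤ (1/2)^n · nup`, `nup = nlow = (3/2)^{K+1} = Σ_T A` (so `LowEnvelope` with `C = 1`); one shape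
per size (`Nanc = Δ₁ = 1`, `ϱ = 1/2`); the bad class = the terms whose top run reaches below `j⋆(K) = K/2`
(`c = 1/2`).  `witness_relWeightBound` feeds ALL of this to `exists_relWeightBound_of_peierls`; `witness_nonvacuous`
shows the bad class is inhabited with positive weight at every `K`.  Value = non-vacuity of the route's END; nothing
about Bałaban's expansion.

HONEST DEPENDENCY (cell, verbatim): continuum YM on T⁴ ⇐ BetaPertH ∧ nine spine estimates (0/9 proved); BetaPertH ⇐
(D1) ∧ (D4) ∧ CAP+tail; G-an2-4 gates asym, D1 and NE2/3/4.  This file changes none of it.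
-/

open Finset

namespace Summit.QuantumFields.BalabanUV.T4Continuum.SpaceTimePeierls.Witness

open Literature.MathematicalPhysics.QuantumFieldTheory.Balaban1983to89
open T4WeightBudget T4StabilitySocket

noncomputable section

/-- the terms at cutoff `K`: all sets of occupied scales `S ⊆ {0, …, K}` [folklore] -/
def wT (K : ℕ) : Finset (Finset ℕ) := (range (K + 1)).powerset

/-- the weight of a term: `(1/2)^{#S}` (source-independent) [folklore] -/
def wA (_K : ℕ) (_t : ℝ) (S : Finset ℕ) : ℝ := (1 / 2 : ℝ) ^ S.card

/-- the top run of length `n`: the scales `{K+1−n, …, K}` [folklore] -/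
def top (K n : ℕ) : Finset ℕ := Icc (K + 1 - n) K

/-- the pinned class of the contour «top run of length exactly `n`»: `S′ ∪ top K n`, `S′ ⊆ {0, …, K−n−1}` [folklore] -/
def wPin (K : ℕ) (_t : ℝ) (n : ℕ) : Finset (Finset ℕ) := (range (K - n)).powerset.image fun S' => S' ∪ top K n

/-- the matching scale `j⋆(K) = K/2` [folklore] -/
def wj (K : ℕ) : ℕ := K / 2

/-- the contour shapes through the top that reach below `j⋆(K)`: run lengths `n ∈ [K − j⋆(K) + 1, K + 1]` [folklore] -/
def wSh (K : ℕ) (_t : ℝ) : Finset ℕ := Icc (K - wj K + 1) (K + 1)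

/-- the bad class: terms whose top run reaches below `j⋆(K)` (= the union of the pinned classes) [folklore] -/
def wBad (K : ℕ) (t : ℝ) : Finset (Finset ℕ) := (wSh K t).biUnion (wPin K t)

/-- the common normalisation `nlow = nup = (3/2)^{K+1} = Σ_T A` [folklore] -/
def wn (K : ℕ) (_t : ℝ) : ℝ := (3 / 2 : ℝ) ^ (K + 1)

/-- the full mass: `Σ_{S ⊆ {0..K}} (1/2)^{#S} = (3/2)^{K+1}` [folklore] -/
theorem sum_wT (K : ℕ) (t : ℝ) : ∑ S ∈ wT K, wA K t S = wn K t := by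
  have h := sum_pow_mul_eq_add_pow (1 / 2 : ℝ) 1 (range (K + 1))
  simp only [one_pow, mul_one, card_range] at h
  rw [wT, wn, show (3 / 2 : ℝ) = 1 / 2 + 1 by norm_num, ← h]
  rfl

/-- the top run has `n` scales (`n ≤ K + 1`) [folklore] -/
theorem card_top {K n : ℕ} (hn : n ≤ K + 1) : (top K n).card = n := by
  rw [top, Nat.card_Icc]; omega

/-- the free part lies strictly below the top run [folklore] -/
theorem disjoint_top {K n : ℕ} {S' : Finset ℕ} (hS' : S' ⊆ range (K - n)) : Disjoint S' (top K n) := by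
  rw [Finset.disjoint_left]
  intro a ha hat
  have h1 := mem_range.1 (hS' ha)
  have h2 := (mem_Icc.1 (show a ∈ Icc (K + 1 - n) K from hat)).1
  omega

/-- pinned classes consist of terms [folklore] -/
theorem wPin_subset (K : ℕ) (t : ℝ) (n : ℕ) : wPin K t n ⊆ wT K := by
  intro S hS
  obtain ⟨S', hS', rfl⟩ := mem_image.1 hS
  rw [wT, mem_powerset]
  refine union_subset ((mem_powerset.1 hS').trans (range_subset_range.2 (by omega))) ?_
  intro a ha
  have := (mem_Icc.1 (show a ∈ Icc (K + 1 - n) K from ha)).2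
  exact mem_range.2 (by omega)

/-- **THE PINNED-CONTOUR BOUND OF THE MODEL**: the class pinned by the top run of length `n ≤ K+1` has mass
`(1/2)^n · (3/2)^{K−n} ≤ (1/2)^n · nup`. [folklore] -/
theorem sum_wPin_le {K n : ℕ} (t : ℝ) (hn : n ≤ K + 1) :
    ∑ S ∈ wPin K t n, wA K t S ≤ (1 / 2 : ℝ) ^ n * wn K t := by
  have hinj : Set.InjOn (fun S' : Finset ℕ => S' ∪ top K n) ↑((range (K - n)).powerset) := by
    intro S₁ h₁ S₂ h₂ h
    have d₁ := disjoint_top (K := K) (n := n) (mem_powerset.1 (mem_coe.1 h₁))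
    have d₂ := disjoint_top (K := K) (n := n) (mem_powerset.1 (mem_coe.1 h₂))
    have := congrArg (fun S : Finset ℕ => S \ top K n) h
    simpa only [Finset.union_sdiff_cancel_right d₁, Finset.union_sdiff_cancel_right d₂] using this
  rw [wPin, sum_image hinj]
  have hcard : ∀ S' ∈ (range (K - n)).powerset, wA K t (S' ∪ top K n) = (1 / 2 : ℝ) ^ n * (1 / 2 : ℝ) ^ S'.card := by
    intro S' hS'
    rw [wA, card_union_of_disjoint (disjoint_top (mem_powerset.1 hS')), card_top hn, pow_add, mul_comm]
  rw [sum_congr rfl hcard, ← mul_sum]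
  refine mul_le_mul_of_nonneg_left ?_ (by positivity)
  have h := sum_pow_mul_eq_add_pow (1 / 2 : ℝ) 1 (range (K - n))
  simp only [one_pow, mul_one, card_range] at h
  rw [h, wn, show (1 / 2 : ℝ) + 1 = 3 / 2 by norm_num]
  exact pow_le_pow_right₀ (by norm_num) (by omega)

/-- the model's denominator: `LowEnvelope` with `nlow = nup = Σ_T A`, `C = 1` [folklore] -/
theorem lowEnvelope_w (l₀ : ℝ) : LowEnvelope l₀ wT wA wn wn 1 0 where
  low K t _ _ := (sum_wT K t).ge
  nup_nonneg K t _ _ := by unfold wn; positivity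
  ratio K t _ _ := by rw [one_mul]

/-- **EVERY BINDER OF THE END AT ONCE**: the model satisfies the hypotheses of `exists_relWeightBound_of_peierls`
(both runs = the model run; `Nanc = Δ₁ = 1`, `s₁ = log 2`, `c = 1/2`, `j⋆(K) = K/2`), hence its conclusion.
[folklore] -/
theorem witness_relWeightBound (l₀ : ℝ) :
    ∃ K₁, 0 ≤ K₁ ∧ RelWeightBound l₀ wT wA wA (fun K t => if K₁ ≤ K then wBad K t else ∅)
      (Set.indicator {K | K₁ ≤ K} (fun K => 1 * contourBudget 1 (1 * Real.exp (-Real.log 2)) wj K)) := by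
  have hq : Real.exp (-Real.log 2) = 1 / 2 := by
    rw [Real.exp_neg, Real.exp_log (by norm_num : (0:ℝ) < 2)]; norm_num
  refine exists_relWeightBound_of_peierls wSh wSh wPin wPin (fun _ n => n) (Nanc := 1) (Δ₁ := 1)
    (s₁ := Real.log 2) (c := 1 / 2) (jstar := wj)
    (fun K t _ _ S _ => by unfold wA; positivity) (fun K t _ _ S _ => by unfold wA; positivity)
    (fun K t _ _ => biUnion_subset.2 fun n _ => wPin_subset K t n)
    (fun K t _ _ n _ => wPin_subset K t n) (fun K t _ _ n _ => wPin_subset K t n)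
    (fun K t _ _ => Subset.rfl) (fun K t _ _ => Subset.rfl)
    (fun K t _ _ n hn => (mem_Icc.1 hn).1) (fun K t _ _ n hn => (mem_Icc.1 hn).1)
    (fun K t _ _ n => ?cnt) (fun K t _ _ n => ?cnt')
    (fun K t _ _ n hn => by rw [hq]; exact sum_wPin_le t (mem_Icc.1 hn).2)
    (fun K t _ _ n hn => by rw [hq]; exact sum_wPin_le t (mem_Icc.1 hn).2)
    (lowEnvelope_w l₀) (lowEnvelope_w l₀) zero_le_one zero_le_one one_pos (by rw [hq]; norm_num)
    (by norm_num) (fun K => ?frac)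
  case cnt | cnt' =>
    have h1 : ((wSh K t).filter fun b => b = n).card ≤ 1 :=
      (card_le_card (by intro b hb; rw [mem_singleton]; exact (mem_filter.1 hb).2)).trans
        (card_singleton n).le
    calc ((((wSh K t).filter fun b => b = n).card : ℕ) : ℝ) ≤ 1 := by exact_mod_cast h1
      _ = 1 * 1 ^ n := by rw [one_pow, one_mul]
  case frac =>
    have h : K ≤ 2 * (K - wj K) := by unfold wj; omega
    have h' : (K : ℝ) ≤ 2 * ((K - wj K : ℕ) : ℝ) := by exact_mod_cast h
    linarith

/-- **NON-VACUITY**: at every cutoff the bad class contains the fully occupied history `{0, …, K}` (its top run has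
length `K + 1 ≥ K − j⋆(K) + 1`), of positive weight `(1/2)^{K+1}`. [folklore] -/
theorem witness_nonvacuous (K : ℕ) (t : ℝ) : range (K + 1) ∈ wBad K t ∧ 0 < wA K t (range (K + 1)) := by
  refine ⟨mem_biUnion.2 ⟨K + 1, mem_Icc.2 ⟨by unfold wj; omega, le_rfl⟩, mem_image.2 ⟨∅, ?_, ?_⟩⟩,
    by unfold wA; positivity⟩
  · simp
  · rw [empty_union, top]
    ext a
    simp only [mem_Icc, mem_range]
    omega

end

end Summit.QuantumFields.BalabanUV.T4Continuum.SpaceTimePeierls.Witness
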